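import Summits.BirchSwinnertonDyer.BirchSwinnertonDyer.Theorems.KolyvaginRoadThreePTEngineOfMiddleExact
import Summits.BirchSwinnertonDyer.BirchSwinnertonDyer.Theorems.KolyvaginRoadThreePTMilneTorsion
import HarnessLib

/-!
# Route `KolyvaginRoadThree`, deciding crux `ZhangSharpFrameAtThreeHL` (item stmt-BirchSwinnertonDyer-19574):
# PT road, step (R) part 7 — S2-ENGINE's registered text is a THEOREM (no Poitou–Tate hypothesis left), and the METHOD
# line's terminal certificate reads «crux ⟸ h₁ → hCT3 → S1 → S2-KS» (cell `bsd-stepL`, ACCEL seat `bsd-stepL-koly3b` g10;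
# `--supports stmt-BirchSwinnertonDyer-19574`, helper)

HONEST FRAMING. Composition only; 0 definitions, 0 named facts, 0 `sorry`, no instance attributes; the crux is NOT claimed
and NOT closed: the terminal certificate is CONDITIONAL on the route's two existing published-input binders (`h₁`, `hCT3`)
and on the TEXTS of the two open stubs S1 and S2-KS, which are the honest open mathematics at `p = 3 ∥ N` (W. Zhang's
Thm. 7.2 at the bottom and his level Kolyvagin systems). What this file REMOVES from the residual is the whole of stub PT:
Poitou–Tate global duality for Selmer structures, until today a NAMED UNPROVED fact (`poitouTate_selmerStructure_duality`),
now — for the one module the line uses, `E[3]` — a kernel theorem by the OWNER's PT road (koly g18–g20: dévissage over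
`K(E[3], μ₃)^{Syl₃}`, prime-to-`3` descent with nine binders, `middleExact_canonical_of_card_eq_sq` p574551,
`middleExact_canonical_torsionGaloisModule`) composed with this seat's step (R) (parts 1–6: the consumer chain re-keyed to
that one module). PARTITION: O2@3 (B10) × A1 × crux 19574 × stub PT — proves (the stub's consumer-side obligation);
closes: none (T7); no class of O2@3 moves.

* `middleExactE3_holds` — the hypothesis `hE3` of parts 4–6 (Milne *ADT* I Thm. 4.10(b) for `(E/K)[3]` and THE invariant
  maps, every admissible `S ⊇ ∞`, every elliptic `E/ℚ`, every imaginary quadratic `K`) IS A THEOREM: the owner's corollary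
  read at level `3 ^ 1` (kernel-defeq numerals); the imaginary-quadratic clause is not even used.
* `stub_inductionOfLevelSystemsAtThree_holds` — the registered S2-ENGINE text `Method2.stub_inductionOfLevelSystemsAtThree`
  of skeleton v3.1 (W. Zhang's induction on good levels at `p = 3`, fed by a level Kolyvagin system, (A1) and the parity),
  UNCONDITIONALLY: part 6 ∘ `middleExactE3_holds`.
* `zhangSharpFrameAtThreeHL_of_routeBinders_of_bottom_of_levelSystems'` — the crux decl BY NAME ⟸ `h₁ =
  PublishedInputsKolyThree` → `hCT3 = ShimuraCasselsTateLevelInputs` → S1 → S2-KS (the owner's (o2) certificate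
  `Method2CruxOfBinders.zhangSharpFrameAtThreeHL_of_routeBinders_of_bottom_of_levelSystems` with its S2-ENGINE binder fed).
  This is the `_of` of the v3.2 reshape (stubs P-mod-binders ∕ S1 ∕ S2-KS; stub PT dropped).

References: [cite: WZhang2014, §9 proof of Thm. 9.1, Thm. 9.2, Lemma 8.2, Lemma 8.4] [cite: MilneADT2006, Ch. I, Thm. 4.10]
[cite: McCallumLMS1991, Prop. 2.1, Lemma 5.3] [cite: GrossLMS1991, Prop. 8.1–8.2, 9.6] [cite: Howard2004HeegnerKolyvagin,
Thm. 2.1.11].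
-/

noncomputable section

open scoped Classical

namespace Summit.BirchSwinnertonDyer.Rank1Residual.X11b.Three.Koly.PTAt

open WeierstrassCurve Field Function NumberField IsDedekindDomain
open Literature.NumberTheory.EllipticCurves Literature.NumberTheory.EllipticCurves.ModularForms
  Literature.NumberTheory.GaloisRepresentations Module
open Literature.NumberTheory.GaloisRepresentations.DiscreteGaloisModule (tateDual localTatePairingZMod unramifiedSubgroup)
open Literature.NumberTheory.GaloisCohomology
open Summit.BirchSwinnertonDyer.Rank1Residual.X11b.Three.Koly.Method2

/-! ## §1 `hE3` is a theorem -/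

/-- **Milne *ADT* I Thm. 4.10(b) `Ker γ¹ ⊆ Im β¹` for `(E/K)[3]` and THE invariant maps `LocalInvariants.canonical K 3`, at
every admissible `S ⊇ ∞`, for every elliptic `E/ℚ` and every (imaginary quadratic) number field `K` — a THEOREM**: the
owner's `KolyvaginRoadThreePT.middleExact_canonical_torsionGaloisModule` (koly g20; ⟸ `middleExact_canonical_of_card_eq_sq`,
every finite discrete `Γ_K`-module of order `p²` killed by an odd prime `p`) read in the `hE3` shape of parts 4–6 (level
spelled `3 ^ 1`; the two clauses `S ⊇ ∞` and `IsImaginaryQuadratic K` are not used).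
[cite: MilneADT2006, Ch. I, Thm. 4.10(b)] -/
theorem middleExactE3_holds : ∀ (W : WeierstrassCurve ℚ) [W.IsElliptic] (K : Type) [Field K] [NumberField K]
      [Finite ((W.baseChange K).geomTorsion ((3 ^ 1 : ℕ) : ℤ))], IsImaginaryQuadratic K →
      ∀ S : Finset (Place K), (∀ w : InfinitePlace K, (Sum.inl w : Place K) ∈ S) →
        (∀ v : HeightOneSpectrum (𝓞 K), (Sum.inr v : Place K) ∉ S →
          (((3 ^ 1 : ℕ) : ℕ) : 𝓞 K) ∉ v.asIdeal ∧
            GaloisRep.IsUnramifiedAt v ((W.baseChange K).torsionGaloisModule ((3 ^ 1 : ℕ) : ℤ))) →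
        ∀ t : Π v : Place K, galoisCohomology (((W.baseChange K).torsionGaloisModule ((3 ^ 1 : ℕ) : ℤ)).toLocal v) 1,
          (∀ y : galoisCohomology (((W.baseChange K).torsionGaloisModule ((3 ^ 1 : ℕ) : ℤ)).tateDual (3 ^ 1 : ℕ)) 1,
            (∀ v : HeightOneSpectrum (𝓞 K), (Sum.inr v : Place K) ∉ S →
              galoisCohomology.localization (((W.baseChange K).torsionGaloisModule ((3 ^ 1 : ℕ) : ℤ)).tateDual
                (3 ^ 1 : ℕ)) (Sum.inr v) 1 y ∈
                unramifiedSubgroup (GaloisRep.toLocal v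
                  (((W.baseChange K).torsionGaloisModule ((3 ^ 1 : ℕ) : ℤ)).tateDual (3 ^ 1 : ℕ))) 1) →
            ∑ v ∈ S, localTatePairingZMod ((W.baseChange K).torsionGaloisModule ((3 ^ 1 : ℕ) : ℤ)) (3 ^ 1 : ℕ) v
              (LocalInvariants.canonical K (3 ^ 1 : ℕ) v) (t v)
              (galoisCohomology.localization (((W.baseChange K).torsionGaloisModule ((3 ^ 1 : ℕ) : ℤ)).tateDual
                (3 ^ 1 : ℕ)) v 1 y) = 0) →
          ∃ x : galoisCohomology ((W.baseChange K).torsionGaloisModule ((3 ^ 1 : ℕ) : ℤ)) 1,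
            (∀ v : HeightOneSpectrum (𝓞 K), (Sum.inr v : Place K) ∉ S →
              galoisCohomology.localization ((W.baseChange K).torsionGaloisModule ((3 ^ 1 : ℕ) : ℤ)) (Sum.inr v) 1 x ∈
                unramifiedSubgroup (GaloisRep.toLocal v ((W.baseChange K).torsionGaloisModule ((3 ^ 1 : ℕ) : ℤ))) 1) ∧
            ∀ v ∈ S, galoisCohomology.localization ((W.baseChange K).torsionGaloisModule ((3 ^ 1 : ℕ) : ℤ)) v 1 x = t v := by
  intro W _ K _ _ _ _hK S _hSinf hS t horth
  haveI : Fact (Nat.Prime 3) := ⟨Nat.prime_three⟩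
  haveI : Finite ((W.baseChange K).geomTorsion ((3 : ℕ) : ℤ)) := finite_geomTorsion_of_neZero (W.baseChange K) 3
  exact Summit.BirchSwinnertonDyer.BirchSwinnertonDyer.Theorems.KolyvaginRoadThreePT.middleExact_canonical_torsionGaloisModule
    (W.baseChange K) (p := 3) ⟨1, rfl⟩ hS t horth

/-! ## §2 S2-ENGINE's registered text, unconditionally -/

/-- **S2-ENGINE — the registered text `Method2.stub_inductionOfLevelSystemsAtThree` of skeleton v3.1 of crux 19574 (W. Zhang's
induction on good levels at `p = 3 ∥ N`: at an HL frame with complex conjugation `c ≠ 1`, a level Kolyvagin system, the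
rank-lowering step (A1) and odd `𝔽₃`-Selmer rank `≥ 3` yield a non-zero Kolyvagin class with Kolyvagin-prime support) —
PROVED with NO named hypothesis**: part 6's `stub_inductionOfLevelSystemsAtThree_of_middleExact` (the chain koly g13–g17 ∕
koly3b g3–g10 ∕ zhang3-p1 g9–g10: Zhang's Lemma 8.4 triangulation ⟸ (Supply) ⟸ signed jump ⟸ Poitou–Tate AT `E[3]` +
Weil + Lagrangian Kummer ∕ ordinary ∕ transverse conditions + Gross's line-rigidity at Kolyvagin primes) ∘ §1.
[cite: WZhang2014, §9 proof of Thm. 9.1, Lemma 8.2, Lemma 8.4] [cite: McCallumLMS1991, Prop. 2.1, Lemma 5.3]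
[cite: MilneADT2006, Ch. I, Thm. 4.10] [cite: GrossLMS1991, Prop. 8.1–8.2, 9.6] -/
theorem stub_inductionOfLevelSystemsAtThree_holds :
    ∀ (W : WeierstrassCurve ℚ) [W.IsElliptic] [W.IsGloballyMinimal] [NeZero (W.conductorNorm ℤ)] (K : Type)
      [Field K] [NumberField K] (Dt : ModularParametrizationData W (W.conductorNorm ℤ)) (β : ℤ) (ι : K →+* ℂ),
      Summit.BirchSwinnertonDyer.Rank1Residual.ClassX11b W 3 → W.HasMultiplicativeReductionAtPrime 3 →
      Rank1Residual.Surj W 3 → Rank1Residual.Ram W 3 → ¬ 3 ∣ W.tamagawaProduct → IsImaginaryQuadratic K →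
      Odd (NumberField.discr K) → SatisfiesHeegnerHypothesis (W.conductorNorm ℤ) K →
      (W.quadraticTwist (NumberField.discr K : ℚ)).entireLFunction 1 ≠ 0 → NumberField.discr K ≠ -3 →
      (4 * (W.conductorNorm ℤ : ℤ)) ∣ β ^ 2 - NumberField.discr K → ¬ (3 : ℤ) ∣ Dt.c →
      ∀ (c : K ≃ₐ[ℚ] K), c ≠ 1 → ∀ [Module (ZMod 3) (V3 W K)],
      LevelKolyvaginSystem W K Dt β ι c →
      (∀ (n : Finset {q // IsUAdmissiblePrime W K q}) (μ : Bool) (x : V3 W K),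
        GoodLevel W K n → x ∈ SelQ W K c n μ → x ≠ 0 →
        ∃ q : {q // IsUAdmissiblePrime W K q}, q ∉ n ∧ GoodLevel W K (insert q n) ∧
          x ∉ SelQ W K c (insert q n) μ ∧
          SelQ W K c (insert q n) μ ≤ SelQ W K c n μ ∧
          finrank (ZMod 3) (SelQ W K c (insert q n) μ) + 1 = finrank (ZMod 3) (SelQ W K c n μ) ∧
          SelQ W K c (insert q n) (!μ) = SelQ W K c n (!μ)) →
      Odd (finrank (ZMod 3)
        (AddSubgroup.toZModSubmodule 3 (selmerGroup (W.baseChange K) ((3 ^ 1 : ℕ) : ℤ)))) →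
      3 ≤ finrank (ZMod 3)
        (AddSubgroup.toZModSubmodule 3 (selmerGroup (W.baseChange K) ((3 ^ 1 : ℕ) : ℤ))) →
      ∃ (n : ℕ) (d : KolyvaginHeegnerData Dt β ι n),
        KolyvaginDescent.KolSupp (Zhang2014.IsKolyvaginPrime (W.conductorNorm ℤ) W K 3) n ∧
          d.kolyvaginClass Nat.prime_three 1 ≠ 0 :=
  stub_inductionOfLevelSystemsAtThree_of_middleExact middleExactE3_holds

/-! ## §3 The terminal certificate of the METHOD line without stub PT -/

/-- **THE TERMINAL CERTIFICATE OF THE METHOD LINE WITHOUT POITOU–TATE.** The crux `ZhangSharpFrameAtThreeHL` BY NAME from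
the two route support decls `PublishedInputsKolyThree` (item 19156, binder `h₁` of `closes`; conjuncts 1, 2, 7 = Gross–Zagier,
Kolyvagin, modularity) and `ShimuraCasselsTateLevelInputs` (item 20191, binder `hCT3`), and the TEXTS of the two open stubs
S1 (`stub_bottomRankOneAtThree`) and S2-KS (`stub_levelKolyvaginSystemsAtThree`) — the owner's (o2) certificate
`Method2CruxOfBinders.zhangSharpFrameAtThreeHL_of_routeBinders_of_bottom_of_levelSystems` (koly g16) with its S2-ENGINE
binder fed by §2. So the METHOD line's residual is EXACTLY {S1, S2-KS}: stub PT of skeleton v3.1 is GONE (the `_of` of the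
v3.2 reshape). CONDITIONAL on the displayed hypotheses; nothing is booked; no class of O2@3 moves; BSD is not proved.
[cite: WZhang2014, §9 proof of Thm. 9.1, Thm. 9.2, Lemma 8.2] [cite: McCallumLMS1991, Prop. 2.1, §5 Cor. 5.6]
[cite: MilneADT2006, Ch. I, Thm. 4.10] -/
theorem zhangSharpFrameAtThreeHL_of_routeBinders_of_bottom_of_levelSystems'
    (h₁ : Summit.BirchSwinnertonDyer.BirchSwinnertonDyer.Theses.KolyvaginRoadThree.PublishedInputsKolyThree)
    (hCT3 : Summit.BirchSwinnertonDyer.BirchSwinnertonDyer.Theses.KolyvaginRoadThree.ShimuraCasselsTateLevelInputs)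
    (hS1 :
      ∀ (W : WeierstrassCurve ℚ) [W.IsElliptic] [W.IsGloballyMinimal] [NeZero (W.conductorNorm ℤ)] (K : Type)
        [Field K] [NumberField K] (Dt : ModularParametrizationData W (W.conductorNorm ℤ)) (β : ℤ) (ι : K →+* ℂ),
        Summit.BirchSwinnertonDyer.Rank1Residual.ClassX11b W 3 → W.HasMultiplicativeReductionAtPrime 3 →
        Rank1Residual.Surj W 3 → Rank1Residual.Ram W 3 → ¬ 3 ∣ W.tamagawaProduct → IsImaginaryQuadratic K →
        Odd (NumberField.discr K) → SatisfiesHeegnerHypothesis (W.conductorNorm ℤ) K →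
        (W.quadraticTwist (NumberField.discr K : ℚ)).entireLFunction 1 ≠ 0 → NumberField.discr K ≠ -3 →
        (4 * (W.conductorNorm ℤ : ℤ)) ∣ β ^ 2 - NumberField.discr K → ¬ (3 : ℤ) ∣ Dt.c →
        ∀ [Module (ZMod 3) (V3 W K)],
        finrank (ZMod 3)
          (AddSubgroup.toZModSubmodule 3 (selmerGroup (W.baseChange K) ((3 ^ 1 : ℕ) : ℤ))) = 1 →
        ∃ d : KolyvaginHeegnerData Dt β ι 1, d.kolyvaginClass Nat.prime_three 1 ≠ 0)
    (hKS :
      ∀ (W : WeierstrassCurve ℚ) [W.IsElliptic] [W.IsGloballyMinimal] [NeZero (W.conductorNorm ℤ)] (K : Type)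
        [Field K] [NumberField K] (Dt : ModularParametrizationData W (W.conductorNorm ℤ)) (β : ℤ) (ι : K →+* ℂ),
        Summit.BirchSwinnertonDyer.Rank1Residual.ClassX11b W 3 → W.HasMultiplicativeReductionAtPrime 3 →
        Rank1Residual.Surj W 3 → Rank1Residual.Ram W 3 → ¬ 3 ∣ W.tamagawaProduct → IsImaginaryQuadratic K →
        Odd (NumberField.discr K) → SatisfiesHeegnerHypothesis (W.conductorNorm ℤ) K →
        (W.quadraticTwist (NumberField.discr K : ℚ)).entireLFunction 1 ≠ 0 → NumberField.discr K ≠ -3 →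
        (4 * (W.conductorNorm ℤ : ℤ)) ∣ β ^ 2 - NumberField.discr K → ¬ (3 : ℤ) ∣ Dt.c →
        ∀ (c : K ≃ₐ[ℚ] K), c ≠ 1 → ∀ [Module (ZMod 3) (V3 W K)],
        Nonempty (LevelKolyvaginSystem W K Dt β ι c)) :
    Summit.BirchSwinnertonDyer.BirchSwinnertonDyer.Theses.KolyvaginRoadThree.ZhangSharpFrameAtThreeHL :=
  Method2CruxOfBinders.zhangSharpFrameAtThreeHL_of_routeBinders_of_bottom_of_levelSystems h₁ hCT3 hS1 hKS
    stub_inductionOfLevelSystemsAtThree_holds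

end Summit.BirchSwinnertonDyer.Rank1Residual.X11b.Three.Koly.PTAt

end
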